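import Summits.NavierStokesRegularity.NavierStokesRegularity.Theorems.IntenseSetDoorsDefs
import Literature.Analysis.FluidPDE.VorticitySupEnstrophyGronwallSharp
import Literature.Analysis.FluidPDE.ConstantinFeffermanStretching
import Literature.Analysis.FluidPDE.TaoEnstrophyLocalisationProofs
import Literature.Analysis.FluidPDE.SobolevWholeSpace
import HarnessLib

/-!
# IntenseSetDoorsMassStretching — door family S34 «IntenseSetDoors» (nsreg-p1 ROUND-32, texts
# `Theorems/IntenseSetDoorsDefs.lean` = `r32/Sketch34.lean` c542dddc314f2f7c), plate T34C

**`criticalMassStretching_holds : CriticalMassStretching`** — door C's fixed-time estimate, `C = 6(K_Sob+1)²`: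
LOW (`|ω| ≤ L`): Chae's pointwise bound; HIGH (`S = {|ω| > L}`): `⟪ω,(∇v)ω⟫ ≤ |ω|² Σⱼ‖∂ⱼv‖`, Hölder `(3/2,3)`
+ Cauchy–Schwarz (`ENNReal.lintegral_mul_le_Lp_mul_Lq`), Sobolev `L⁶ ≤ K‖∇·‖₂` for `ω` and for the slices
`∂ⱼv` (div-free, `C²`), `∫‖∇∂ⱼv‖² ≤ ∫|curl ∂ⱼv|² = ∫|∂ⱼω|² ≤ ∫|∇ω|²_F`. HONEST FRAME: S34 = regularity
CRITERIA on the scale-critical intense set, Type-II-inclusive; nothing here bears on 0056 or NS regularity.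
-/

noncomputable section

set_option linter.dupNamespace false

namespace Summit.NavierStokesRegularity.NavierStokesRegularity.Theorems.IntenseSetDoors

open MeasureTheory Set Function Filter Metric Real InnerProductSpace
open _root_.Topology
open scoped ENNReal NNReal RealInnerProductSpace
open Literature.Analysis Literature.Analysis.FluidPDE

-- nested operator types (second derivatives)
set_option maxSynthPendingDepth 3

/-- `‖A‖ ≤ Σⱼ ‖A eⱼ‖` for the standard basis of `ℝ³`. [folklore] -/
theorem opNorm_le_sum_norm_apply_basisFun {F : Type*} [NormedAddCommGroup F] [NormedSpace ℝ F]
    (A : EuclideanSpace ℝ (Fin 3) →L[ℝ] F) :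
    ‖A‖ ≤ ∑ j, ‖A (EuclideanSpace.basisFun (Fin 3) ℝ j)‖ := by
  refine ContinuousLinearMap.opNorm_le_bound _ (Finset.sum_nonneg fun j _ => norm_nonneg _)
    fun h => ?_
  have hrepr : h = ∑ j, h j • EuclideanSpace.basisFun (Fin 3) ℝ j := by
    simpa using ((EuclideanSpace.basisFun (Fin 3) ℝ).sum_repr h).symm
  calc ‖A h‖ = ‖∑ j, h j • A (EuclideanSpace.basisFun (Fin 3) ℝ j)‖ := by
        conv_lhs => rw [hrepr]
        simp only [map_sum, map_smul]
    _ ≤ ∑ j, ‖h j • A (EuclideanSpace.basisFun (Fin 3) ℝ j)‖ := norm_sum_le _ _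
    _ ≤ ∑ j, ‖A (EuclideanSpace.basisFun (Fin 3) ℝ j)‖ * ‖h‖ := by
        refine Finset.sum_le_sum fun j _ => ?_
        rw [norm_smul, mul_comm]
        exact mul_le_mul_of_nonneg_left (by simpa using PiLp.norm_apply_le h j)
          (norm_nonneg _)
    _ = (∑ j, ‖A (EuclideanSpace.basisFun (Fin 3) ℝ j)‖) * ‖h‖ := by rw [Finset.sum_mul]

/-- `‖A eⱼ‖² ≤ |A|²_F` for the standard basis of `ℝ³`. [folklore] -/
theorem sq_norm_apply_basisFun_le_frobeniusNormSq {F : Type*} [NormedAddCommGroup F]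
    [InnerProductSpace ℝ F] [FiniteDimensional ℝ F]
    (A : EuclideanSpace ℝ (Fin 3) →L[ℝ] F) (j : Fin 3) :
    ‖A (EuclideanSpace.basisFun (Fin 3) ℝ j)‖ ^ 2 ≤ frobeniusNormSq A := by
  rw [frobeniusNormSq_eq_sum (EuclideanSpace.basisFun (Fin 3) ℝ)]
  exact Finset.single_le_sum (f := fun i => ‖A (EuclideanSpace.basisFun (Fin 3) ℝ i)‖ ^ 2)
    (fun i _ => sq_nonneg _) (Finset.mem_univ j)

/-- From `‖f‖_{L⁶} ≤ c`: `(∫ (‖f‖ₑ³)²)^{1/2} ≤ c³`. [folklore] -/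
theorem lintegral_pow_six_rpow_half_le {α E' : Type*} [MeasurableSpace α] {μ : Measure α}
    [NormedAddCommGroup E'] {f : α → E'} {c : ℝ} (hc : 0 ≤ c)
    (h6 : eLpNorm f 6 μ ≤ ENNReal.ofReal c) :
    (∫⁻ x, (‖f x‖ₑ ^ 3) ^ 2 ∂μ) ^ (1 / (2 : ℝ)) ≤ ENNReal.ofReal (c ^ 3) := by
  have hrepr := eLpNorm_eq_lintegral_rpow_enorm_toReal (μ := μ) (f := f)
    (by norm_num : (6 : ℝ≥0∞) ≠ 0) (by norm_num : (6 : ℝ≥0∞) ≠ ⊤)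
  have h6r : (6 : ℝ≥0∞).toReal = 6 := by norm_num
  rw [h6r] at hrepr
  have hI : ∫⁻ x, ‖f x‖ₑ ^ (6 : ℝ) ∂μ = eLpNorm f 6 μ ^ (6 : ℝ) := by
    rw [hrepr, ← ENNReal.rpow_mul]; norm_num
  have hpt6 : ∀ x, (‖f x‖ₑ ^ 3) ^ 2 = ‖f x‖ₑ ^ (6 : ℝ) := fun x => by
    rw [← pow_mul, show (6 : ℝ) = ((6 : ℕ) : ℝ) by norm_num, ENNReal.rpow_natCast]
  have h6' : ∫⁻ x, (‖f x‖ₑ ^ 3) ^ 2 ∂μ ≤ ENNReal.ofReal c ^ (6 : ℝ) := by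
    simp_rw [hpt6]
    rw [hI]
    exact ENNReal.rpow_le_rpow h6 (by norm_num)
  refine (ENNReal.rpow_le_rpow h6' (by norm_num)).trans (le_of_eq ?_)
  rw [← ENNReal.rpow_mul, show (6 : ℝ) * (1 / 2) = ((3 : ℕ) : ℝ) by norm_num,
    ENNReal.rpow_natCast, ENNReal.ofReal_pow hc]

set_option maxHeartbeats 3200000 in
/-- **Plate T34C «CriticalMassStretching»** (door C's fixed-time estimate: Chae below the level,
Hölder `L^{3/2}(S) × L⁶ × L⁶` and Sobolev twice above it). [folklore] -/
theorem criticalMassStretching_holds : CriticalMassStretching := by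
  set K₀ : ℝ≥0 := SNormLESNormFDerivOfEqConst (EuclideanSpace ℝ (Fin 3))
    (volume : Measure (EuclideanSpace ℝ (Fin 3))) 2 with hK₀
  set K : ℝ := (K₀ : ℝ) + 1 with hK
  have hK0 : 0 < K := by rw [hK]; positivity
  refine ⟨6 * K ^ 2, by positivity, ?_⟩
  intro L hL v hv hdiv _ hG hH hbd
  obtain ⟨B, hB⟩ := hbd
  set b := EuclideanSpace.basisFun (Fin 3) ℝ with hb
  have hv2 : ContDiff ℝ 2 v := hv.of_le (by norm_num)
  have hv1 : ContDiff ℝ 1 v := hv.of_le (by norm_num)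
  have hDv : Continuous (fderiv ℝ v) := hv1.continuous_fderiv one_ne_zero
  have hω1 : ContDiff ℝ 1 (curl v) := contDiff_curl (n := 1) (by exact hv2)
  have hωc : Continuous (curl v) := hω1.continuous
  have hDω : Continuous (fderiv ℝ (curl v)) := hω1.continuous_fderiv one_ne_zero
  have hωle : ∀ x, ‖curl v x‖ ≤ ‖curlCLM‖ * ‖fderiv ℝ v x‖ := fun x => norm_curl_le v x
  have Iω : Integrable fun x => ‖curl v x‖ ^ 2 := by
    refine (hG.const_mul (‖curlCLM‖ ^ 2)).mono' ((hωc.norm.pow 2).aestronglyMeasurable)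
      (Eventually.of_forall fun x => ?_)
    rw [Real.norm_of_nonneg (sq_nonneg _), ← mul_pow]
    exact pow_le_pow_left₀ (norm_nonneg _) (hωle x) 2
  have Ifv : Integrable fun x => frobeniusNormSq (fderiv ℝ v x) := by
    refine (hG.const_mul 3).mono' (continuous_frobeniusNormSq_fderiv hv2 (by norm_num)).aestronglyMeasurable
      (Eventually.of_forall fun x => ?_)
    rw [Real.norm_of_nonneg (frobeniusNormSq_nonneg _)]
    exact frobeniusNormSq_le_three_mul _
  set F : ℝ := ∫ x, frobeniusNormSq (fderiv ℝ v x) with hF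
  set D : ℝ := ∫ x, frobeniusNormSq (fderiv ℝ (curl v) x) with hD
  have hF0 : 0 ≤ F := integral_nonneg fun x => frobeniusNormSq_nonneg _
  have hD0 : 0 ≤ D := integral_nonneg fun x => frobeniusNormSq_nonneg _
  set sD : ℝ := Real.sqrt D with hsD
  have hsD0 : 0 ≤ sD := Real.sqrt_nonneg _
  have hsD2 : sD ^ 2 = D := Real.sq_sqrt hD0
  set S : Set (EuclideanSpace ℝ (Fin 3)) := {x | L < ‖curl v x‖} with hS
  have hSo : IsOpen S := isOpen_lt continuous_const hωc.norm
  have hSm : MeasurableSet S := hSo.measurableSet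
  have hω0 : Tendsto (curl v) (cocompact (EuclideanSpace ℝ (Fin 3))) (𝓝 0) :=
    tendsto_curl_cocompact hv2 hG hB
  obtain ⟨t, ht, hts⟩ := mem_cocompact.1 (Metric.tendsto_nhds.1 hω0 L hL)
  have hSt : S ⊆ t := by
    intro y hy
    by_contra hyt
    have h := hts hyt
    simp only [mem_setOf_eq, dist_zero_right] at h
    exact lt_irrefl _ ((show L < ‖curl v y‖ from hy).trans h)
  have hμS : volume S < ⊤ := (measure_mono hSt).trans_lt ht.measure_lt_top
  obtain ⟨M₁, hM₁⟩ := ht.exists_bound_of_continuousOn hωc.continuousOn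
  set Mω : ℝ := max M₁ L with hMω
  have hMω0 : 0 ≤ Mω := hL.le.trans (le_max_right _ _)
  have hωbd : ∀ y, ‖curl v y‖ ≤ Mω := by
    intro y
    by_cases hyt : y ∈ t
    · exact (hM₁ y hyt).trans (le_max_left _ _)
    · have h := hts hyt
      simp only [mem_setOf_eq, dist_zero_right] at h
      exact h.le.trans (le_max_right _ _)
  set s : (EuclideanSpace ℝ (Fin 3)) → ℝ := fun x => ⟪curl v x, fderiv ℝ v x (curl v x)⟫ with hs
  have hsc : Continuous s := hωc.inner (hDv.clm_apply hωc)
  have Idom2 : Integrable fun x => (‖curl v x‖ ^ 2 + ‖fderiv ℝ v x‖ ^ 2) / 2 := by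
    have h := (Iω.add hG).div_const 2
    exact h
  have IωDv : Integrable fun x => ‖curl v x‖ * ‖fderiv ℝ v x‖ := by
    refine Idom2.mono' (hωc.norm.mul hDv.norm).aestronglyMeasurable
      (Eventually.of_forall fun x => ?_)
    rw [Real.norm_of_nonneg (mul_nonneg (norm_nonneg _) (norm_nonneg _))]
    nlinarith [sq_nonneg (‖curl v x‖ - ‖fderiv ℝ v x‖)]
  have hs_abs : ∀ x, |s x| ≤ Mω * (‖curl v x‖ * ‖fderiv ℝ v x‖) := by
    intro x
    calc |s x| ≤ ‖curl v x‖ * ‖fderiv ℝ v x (curl v x)‖ := abs_real_inner_le_norm _ _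
      _ ≤ ‖curl v x‖ * (‖fderiv ℝ v x‖ * ‖curl v x‖) :=
          mul_le_mul_of_nonneg_left (ContinuousLinearMap.le_opNorm _ _) (norm_nonneg _)
      _ = ‖curl v x‖ * (‖curl v x‖ * ‖fderiv ℝ v x‖) := by ring
      _ ≤ Mω * (‖curl v x‖ * ‖fderiv ℝ v x‖) :=
          mul_le_mul_of_nonneg_right (hωbd x) (by positivity)
  have Is : Integrable s := by
    refine (IωDv.const_mul Mω).mono' hsc.aestronglyMeasurable (Eventually.of_forall fun x => ?_)
    rw [Real.norm_eq_abs]; exact hs_abs x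
  have IsL : Integrable (Sᶜ.indicator s) := Is.indicator hSm.compl
  have IsH : Integrable (S.indicator s) := Is.indicator hSm
  have hsplit : ∫ x, s x = (∫ x, Sᶜ.indicator s x) + ∫ x, S.indicator s x := by
    rw [← integral_add IsL IsH]
    refine integral_congr_ae (Eventually.of_forall fun x => ?_)
    have h := congr_fun (Set.indicator_compl_add_self S s) x
    rw [Pi.add_apply] at h
    exact h.symm
  have hlow : 2 * ∫ x, Sᶜ.indicator s x ≤ 2 / Real.sqrt 3 * L * F := by
    have hpt : ∀ x, 2 * Sᶜ.indicator s x ≤ 2 / Real.sqrt 3 * L * frobeniusNormSq (fderiv ℝ v x) := by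
      intro x
      have hrhs0 : 0 ≤ 2 / Real.sqrt 3 * L * frobeniusNormSq (fderiv ℝ v x) := by
        have := frobeniusNormSq_nonneg (fderiv ℝ v x); positivity
      by_cases hx : x ∈ S
      · rw [indicator_of_notMem (fun h => (Set.mem_compl_iff _ _).1 h hx), mul_zero]; exact hrhs0
      · rw [indicator_of_mem (mem_compl hx)]
        have hle : ‖curl v x‖ ≤ L := not_lt.1 hx
        exact two_mul_inner_curl_fderiv_le_of_divergence_eq_zero (hdiv x) hle
    have h1 : ∫ x, 2 * Sᶜ.indicator s x ≤ ∫ x, 2 / Real.sqrt 3 * L * frobeniusNormSq (fderiv ℝ v x) :=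
      integral_mono (IsL.const_mul 2) (Ifv.const_mul _) hpt
    rw [integral_const_mul, integral_const_mul] at h1
    exact h1
  set g : (EuclideanSpace ℝ (Fin 3)) → ℝ := S.indicator fun x => ‖curl v x‖ ^ 2 * ‖fderiv ℝ v x‖
    with hg
  have hg0 : ∀ x, 0 ≤ g x := fun x => indicator_nonneg (fun y _ => by positivity) _
  have Ig : Integrable g := by
    refine (IωDv.const_mul Mω).mono'
      (((hωc.norm.pow 2).mul hDv.norm).aestronglyMeasurable.indicator hSm)
      (Eventually.of_forall fun x => ?_)
    rw [Real.norm_of_nonneg (hg0 x)]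
    by_cases hx : x ∈ S
    · rw [hg, indicator_of_mem hx]
      calc ‖curl v x‖ ^ 2 * ‖fderiv ℝ v x‖ = ‖curl v x‖ * (‖curl v x‖ * ‖fderiv ℝ v x‖) := by ring
        _ ≤ Mω * (‖curl v x‖ * ‖fderiv ℝ v x‖) :=
            mul_le_mul_of_nonneg_right (hωbd x) (by positivity)
    · rw [hg, indicator_of_notMem hx]; positivity
  have hsH_le : ∫ x, S.indicator s x ≤ ∫ x, g x := by
    refine integral_mono IsH Ig fun x => ?_
    by_cases hx : x ∈ S
    · simp only [hg, indicator_of_mem hx]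
      calc s x ≤ |s x| := le_abs_self _
        _ ≤ ‖curl v x‖ * ‖fderiv ℝ v x (curl v x)‖ := abs_real_inner_le_norm _ _
        _ ≤ ‖curl v x‖ * (‖fderiv ℝ v x‖ * ‖curl v x‖) :=
            mul_le_mul_of_nonneg_left (ContinuousLinearMap.le_opNorm _ _) (norm_nonneg _)
        _ = ‖curl v x‖ ^ 2 * ‖fderiv ℝ v x‖ := by ring
    · simp only [hg, indicator_of_notMem hx, le_refl]
  set vs : Fin 3 → (EuclideanSpace ℝ (Fin 3)) → (EuclideanSpace ℝ (Fin 3)) :=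
    fun j y => fderiv ℝ v y (b j) with hvs
  have hvs2 : ∀ j, ContDiff ℝ 2 (vs j) := fun j =>
    (hv.fderiv_right (m := 2) (by norm_num)).clm_apply contDiff_const
  have hvs1 : ∀ j, ContDiff ℝ 1 (vs j) := fun j => (hvs2 j).of_le (by norm_num)
  have hvsc : ∀ j, Continuous (vs j) := fun j => (hvs1 j).continuous
  have hb1 : ∀ j, ‖b j‖ = 1 := fun j => by simp [hb]
  have hvsle : ∀ j y, ‖vs j y‖ ≤ ‖fderiv ℝ v y‖ := fun j y => by
    calc ‖fderiv ℝ v y (b j)‖ ≤ ‖fderiv ℝ v y‖ * ‖b j‖ := ContinuousLinearMap.le_opNorm _ _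
      _ = ‖fderiv ℝ v y‖ := by rw [hb1, mul_one]
  have Ivs : ∀ j, Integrable fun y => ‖vs j y‖ ^ 2 := fun j =>
    hG.mono' (((hvsc j).norm.pow 2).aestronglyMeasurable) (Eventually.of_forall fun y => by
      rw [Real.norm_of_nonneg (sq_nonneg _)]
      exact pow_le_pow_left₀ (norm_nonneg _) (hvsle j y) 2)
  have hvsm2 : ∀ j, MemLp (vs j) 2 volume := fun j =>
    (memLp_two_iff_integrable_sq_norm (hvsc j).aestronglyMeasurable).2 (Ivs j)
  have hvsl2 : ∀ j, ∫⁻ y, ‖vs j y‖ₑ ^ 2 < ⊤ := fun j => lintegral_enorm_sq_lt_top_of_integrable_sq (Ivs j)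
  have hvsdiv : ∀ j, VectorCalculus.IsDivFree (vs j) := fun j =>
    VectorCalculus.IsDivFree.fderiv_apply hv2 hdiv (b j)
  have hDωle : ∀ x, ‖fderiv ℝ (curl v) x‖ ≤ ‖curlCLM‖ * ‖fderiv ℝ (fderiv ℝ v) x‖ := fun x => by
    rw [fderiv_curl hv2]; exact ContinuousLinearMap.opNorm_comp_le _ _
  have IDω : Integrable fun x => ‖fderiv ℝ (curl v) x‖ ^ 2 := by
    refine (hH.const_mul (‖curlCLM‖ ^ 2)).mono' ((hDω.norm.pow 2).aestronglyMeasurable)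
      (Eventually.of_forall fun x => ?_)
    rw [Real.norm_of_nonneg (sq_nonneg _), ← mul_pow]
    exact pow_le_pow_left₀ (norm_nonneg _) (hDωle x) 2
  have Ifω : Integrable fun x => frobeniusNormSq (fderiv ℝ (curl v) x) := by
    refine (IDω.const_mul 3).mono' (continuous_frobeniusNormSq_fderiv hω1 one_ne_zero).aestronglyMeasurable
      (Eventually.of_forall fun x => ?_)
    rw [Real.norm_of_nonneg (frobeniusNormSq_nonneg _)]
    exact frobeniusNormSq_le_three_mul _
  have hDl : ∫⁻ x, ENNReal.ofReal (frobeniusNormSq (fderiv ℝ (curl v) x)) = ENNReal.ofReal D := by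
    rw [hD, ofReal_integral_eq_lintegral_ofReal Ifω (Eventually.of_forall fun x => frobeniusNormSq_nonneg _)]
  have hωm2 : MemLp (curl v) 2 volume := (memLp_two_iff_integrable_sq_norm hωc.aestronglyMeasurable).2 Iω
  have hK₀K : (K₀ : ℝ≥0∞) ≤ ENNReal.ofReal K := by
    rw [hK, show ((K₀ : ℝ) + 1 : ℝ) = ((K₀ + 1 : ℝ≥0) : ℝ) by push_cast; ring,
      ENNReal.ofReal_coe_nnreal]
    exact_mod_cast le_self_add
  have hopfrob : ∀ (A : (EuclideanSpace ℝ (Fin 3)) →L[ℝ] (EuclideanSpace ℝ (Fin 3))),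
      ‖A‖ₑ ^ 2 ≤ ENNReal.ofReal (frobeniusNormSq A) := fun A => by
    rw [← ofReal_norm, ← ENNReal.ofReal_pow (norm_nonneg _)]
    exact ENNReal.ofReal_le_ofReal (sq_opNorm_le_frobeniusNormSq A)
  have hsqrt : ∀ (f : (EuclideanSpace ℝ (Fin 3)) → ((EuclideanSpace ℝ (Fin 3)) →L[ℝ] (EuclideanSpace ℝ (Fin 3)))),
      ∫⁻ x, ‖f x‖ₑ ^ 2 ≤ ENNReal.ofReal D → eLpNorm f 2 volume ≤ ENNReal.ofReal sD := by
    intro f hf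
    rw [eLpNorm_eq_lintegral_rpow_enorm_toReal (by norm_num : (2 : ℝ≥0∞) ≠ 0) (by norm_num : (2 : ℝ≥0∞) ≠ ⊤)]
    have h2r : (2 : ℝ≥0∞).toReal = 2 := by norm_num
    rw [h2r]
    have e2 : ∫⁻ x, ‖f x‖ₑ ^ (2 : ℝ) = ∫⁻ x, ‖f x‖ₑ ^ 2 := lintegral_congr fun x => by
      rw [show (2 : ℝ) = ((2 : ℕ) : ℝ) by norm_num, ENNReal.rpow_natCast]
    rw [e2]
    calc (∫⁻ x, ‖f x‖ₑ ^ 2) ^ (1 / (2 : ℝ)) ≤ (ENNReal.ofReal D) ^ (1 / (2 : ℝ)) :=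
          ENNReal.rpow_le_rpow hf (by norm_num)
      _ = ENNReal.ofReal sD := by
          rw [ENNReal.ofReal_rpow_of_nonneg hD0 (by norm_num), hsD, Real.sqrt_eq_rpow]
  have hDω2 : ∫⁻ x, ‖fderiv ℝ (curl v) x‖ₑ ^ 2 ≤ ENNReal.ofReal D := by
    rw [← hDl]; exact lintegral_mono fun x => hopfrob _
  have hω6e : eLpNorm (curl v) 6 volume ≤ ENNReal.ofReal (K * sD) := by
    have hsob := eLpNorm_six_le_eLpNorm_fderiv_two (volume : Measure (EuclideanSpace ℝ (Fin 3)))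
      (F := (EuclideanSpace ℝ (Fin 3))) finrank_euclideanSpace_fin hω1 hωm2.eLpNorm_lt_top
    refine hsob.trans ?_
    rw [ENNReal.ofReal_mul hK0.le]
    exact mul_le_mul' hK₀K (hsqrt _ hDω2)
  have hvs6 : ∀ j, eLpNorm (vs j) 6 volume ≤ ENNReal.ofReal (K * sD) := by
    intro j
    have hsob := eLpNorm_six_le_eLpNorm_fderiv_two (volume : Measure (EuclideanSpace ℝ (Fin 3)))
      (F := (EuclideanSpace ℝ (Fin 3))) finrank_euclideanSpace_fin (hvs1 j) (hvsm2 j).eLpNorm_lt_top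
    refine hsob.trans ?_
    rw [ENNReal.ofReal_mul hK0.le]
    refine mul_le_mul' hK₀K (hsqrt _ ?_)
    calc ∫⁻ x, ‖fderiv ℝ (vs j) x‖ₑ ^ 2
        ≤ ∫⁻ x, ENNReal.ofReal (frobeniusNormSq (fderiv ℝ (vs j) x)) := lintegral_mono fun x => hopfrob _
      _ ≤ ∫⁻ x, ‖curl (vs j) x‖ₑ ^ 2 :=
          lintegral_frobeniusNormSq_fderiv_le_lintegral_sq_norm_curl (hvs2 j) (hvsdiv j) (hvsl2 j)
      _ = ∫⁻ x, ‖fderiv ℝ (curl v) x (b j)‖ₑ ^ 2 := lintegral_congr fun x => by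
          simp only [hvs, curl_fderiv_apply hv2 x (b j)]
      _ ≤ ∫⁻ x, ENNReal.ofReal (frobeniusNormSq (fderiv ℝ (curl v) x)) := lintegral_mono fun x => by
          rw [← ofReal_norm, ← ENNReal.ofReal_pow (norm_nonneg _)]
          exact ENNReal.ofReal_le_ofReal (sq_norm_apply_basisFun_le_frobeniusNormSq _ j)
      _ = ENNReal.ofReal D := hDl
  set Gr : (EuclideanSpace ℝ (Fin 3)) → ℝ := fun x => ∑ j, ‖vs j x‖ with hGr
  have hGr0 : ∀ x, 0 ≤ Gr x := fun x => Finset.sum_nonneg fun j _ => norm_nonneg _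
  have hGrc : Continuous Gr := continuous_finsetSum _ fun j _ => (hvsc j).norm
  have hDvGr : ∀ x, ‖fderiv ℝ v x‖ ≤ Gr x := fun x => opNorm_le_sum_norm_apply_basisFun _
  have hGr6 : eLpNorm Gr 6 volume ≤ ENNReal.ofReal (3 * (K * sD)) := by
    have hfun : Gr = ∑ j, fun x => ‖vs j x‖ := by
      funext x; simp only [hGr, Finset.sum_apply]
    rw [hfun]
    calc eLpNorm (∑ j, fun x => ‖vs j x‖) 6 volume ≤ ∑ j, eLpNorm (fun x => ‖vs j x‖) 6 volume :=
          eLpNorm_sum_le (fun j _ => (hvsc j).norm.aestronglyMeasurable) (by norm_num)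
      _ = ∑ j, eLpNorm (vs j) 6 volume := Finset.sum_congr rfl fun j _ => eLpNorm_norm (vs j)
      _ ≤ ∑ _j : Fin 3, ENNReal.ofReal (K * sD) := Finset.sum_le_sum fun j _ => hvs6 j
      _ = ENNReal.ofReal (3 * (K * sD)) := by
          simp only [Finset.sum_const, Finset.card_univ, Fintype.card_fin, nsmul_eq_mul, Nat.cast_ofNat]
          rw [ENNReal.ofReal_mul (by norm_num : (0:ℝ) ≤ 3), ENNReal.ofReal_ofNat]
  set f : (EuclideanSpace ℝ (Fin 3)) → ℝ≥0∞ := S.indicator fun x => ‖curl v x‖ₑ with hf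
  set h : (EuclideanSpace ℝ (Fin 3)) → ℝ≥0∞ := fun x => ‖curl v x‖ₑ * ‖Gr x‖ₑ with hh
  have hfm : Measurable f := (hωc.measurable.enorm).indicator hSm
  have hhm : Measurable h := hωc.measurable.enorm.mul hGrc.measurable.enorm
  have hpt : ∀ x, ENNReal.ofReal (g x) ≤ f x * h x := by
    intro x
    by_cases hx : x ∈ S
    · simp only [hg, hf, hh, indicator_of_mem hx]
      rw [ENNReal.ofReal_mul (sq_nonneg _), ENNReal.ofReal_pow (norm_nonneg _), ofReal_norm, sq,
        mul_assoc]
      refine mul_le_mul_right (mul_le_mul_right ?_ _) _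
      have e2 : ‖Gr x‖ₑ = ENNReal.ofReal (Gr x) := Real.enorm_eq_ofReal (hGr0 x)
      rw [e2]
      exact ENNReal.ofReal_le_ofReal (hDvGr x)
    · simp only [hg, hf, indicator_of_notMem hx, ENNReal.ofReal_zero, zero_mul, le_refl]
  have hHC : (3 / 2 : ℝ).HolderConjugate 3 :=
    { inv_add_inv_eq_inv := by norm_num
      left_pos := by norm_num
      right_pos := by norm_num }
  have hH1 := ENNReal.lintegral_mul_le_Lp_mul_Lq volume hHC hfm.aemeasurable hhm.aemeasurable
  simp only [Pi.mul_apply] at hH1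
  set m : ℝ := ∫ x in S, ‖curl v x‖ ^ (3 / 2 : ℝ) with hm
  have hm0 : 0 ≤ m := setIntegral_nonneg hSm fun x _ => Real.rpow_nonneg (norm_nonneg _) _
  have hmass : (∫⁻ a, f a ^ (3 / 2 : ℝ)) ^ (1 / (3 / 2 : ℝ)) = ENNReal.ofReal (m ^ (2 / 3 : ℝ)) := by
    have hind : ∀ a, f a ^ (3 / 2 : ℝ) =
        S.indicator (fun x => ENNReal.ofReal (‖curl v x‖ ^ (3 / 2 : ℝ))) a := by
      intro a
      by_cases ha : a ∈ S
      · simp only [hf, indicator_of_mem ha]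
        rw [← ofReal_norm, ENNReal.ofReal_rpow_of_nonneg (norm_nonneg _) (by norm_num)]
      · simp only [hf, indicator_of_notMem ha]
        exact ENNReal.zero_rpow_of_pos (by norm_num)
    have hφc : Continuous fun x => ‖curl v x‖ ^ (3 / 2 : ℝ) :=
      hωc.norm.rpow_const fun x => Or.inr (by norm_num)
    have hIon : IntegrableOn (fun x => ‖curl v x‖ ^ (3 / 2 : ℝ)) S volume :=
      (hφc.continuousOn.integrableOn_compact ht).mono_set hSt
    rw [lintegral_congr hind, lintegral_indicator hSm,
      ← ofReal_integral_eq_lintegral_ofReal hIon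
        (Eventually.of_forall fun x => Real.rpow_nonneg (norm_nonneg _) _)]
    rw [show (1 / (3 / 2 : ℝ)) = (2 / 3 : ℝ) by norm_num, ENNReal.ofReal_rpow_of_nonneg hm0 (by norm_num)]
  have hcube : (∫⁻ a, h a ^ (3 : ℝ)) ^ (1 / (3 : ℝ)) ≤ ENNReal.ofReal (3 * K ^ 2 * D) := by
    have e3 : ∀ a, h a ^ (3 : ℝ) = ‖curl v a‖ₑ ^ 3 * ‖Gr a‖ₑ ^ 3 := fun a => by
      rw [show (3 : ℝ) = ((3 : ℕ) : ℝ) by norm_num, ENNReal.rpow_natCast]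
      simp only [hh]
      rw [mul_pow]
    have hcs := ENNReal.lintegral_mul_le_Lp_mul_Lq volume Real.HolderConjugate.two_two
      ((hωc.measurable.enorm).pow_const 3).aemeasurable
      ((hGrc.measurable.enorm).pow_const 3).aemeasurable
    simp only [Pi.mul_apply] at hcs
    have e2 : ∀ (G : (EuclideanSpace ℝ (Fin 3)) → ℝ≥0∞), ∫⁻ x, G x ^ (2 : ℝ) = ∫⁻ x, G x ^ 2 :=
      fun G => lintegral_congr fun x => by
        rw [show (2 : ℝ) = ((2 : ℕ) : ℝ) by norm_num, ENNReal.rpow_natCast]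
    rw [e2, e2] at hcs
    have hA := lintegral_pow_six_rpow_half_le (μ := volume) (by positivity : 0 ≤ K * sD) hω6e
    have hB := lintegral_pow_six_rpow_half_le (μ := volume) (by positivity : 0 ≤ 3 * (K * sD)) hGr6
    have hprod : ∫⁻ a, h a ^ (3 : ℝ) ≤ ENNReal.ofReal (((K * sD) * (3 * (K * sD))) ^ 3) := by
      rw [lintegral_congr e3]
      refine hcs.trans ?_
      rw [mul_pow, ENNReal.ofReal_mul (by positivity)]
      exact mul_le_mul' hA hB
    calc (∫⁻ a, h a ^ (3 : ℝ)) ^ (1 / (3 : ℝ))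
        ≤ (ENNReal.ofReal (((K * sD) * (3 * (K * sD))) ^ 3)) ^ (1 / (3 : ℝ)) :=
          ENNReal.rpow_le_rpow hprod (by norm_num)
      _ = ENNReal.ofReal ((K * sD) * (3 * (K * sD))) := by
          rw [ENNReal.ofReal_rpow_of_nonneg (by positivity) (by norm_num), ← Real.rpow_natCast,
            ← Real.rpow_mul (by positivity)]
          norm_num
      _ = ENNReal.ofReal (3 * K ^ 2 * D) := by
          congr 1
          rw [← hsD2]; ring
  -- ### HIGH assembled
  have hIg : ∫ x, g x ≤ m ^ (2 / 3 : ℝ) * (3 * K ^ 2 * D) := by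
    have h1 : ENNReal.ofReal (∫ x, g x) = ∫⁻ x, ENNReal.ofReal (g x) :=
      ofReal_integral_eq_lintegral_ofReal Ig (Eventually.of_forall hg0)
    have h2 : ∫⁻ x, ENNReal.ofReal (g x) ≤
        ENNReal.ofReal (m ^ (2 / 3 : ℝ)) * ENNReal.ofReal (3 * K ^ 2 * D) := by
      calc ∫⁻ x, ENNReal.ofReal (g x) ≤ ∫⁻ x, f x * h x := lintegral_mono fun x => hpt x
        _ ≤ (∫⁻ a, f a ^ (3 / 2 : ℝ)) ^ (1 / (3 / 2 : ℝ)) * (∫⁻ a, h a ^ (3 : ℝ)) ^ (1 / (3 : ℝ)) := hH1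
        _ ≤ ENNReal.ofReal (m ^ (2 / 3 : ℝ)) * ENNReal.ofReal (3 * K ^ 2 * D) := by
            rw [hmass]; exact mul_le_mul_right hcube _
    rw [← h1, ← ENNReal.ofReal_mul (Real.rpow_nonneg hm0 _)] at h2
    exact (ENNReal.ofReal_le_ofReal_iff (by positivity)).1 h2
  -- ### conclusion
  have hhigh : 2 * ∫ x, S.indicator s x ≤ 6 * K ^ 2 * m ^ (2 / 3 : ℝ) * D := by
    have := hsH_le.trans hIg
    nlinarith [this, hm0, Real.rpow_nonneg hm0 (2 / 3 : ℝ), hD0, hK0]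
  show 2 * ∫ x, s x ≤ 2 / Real.sqrt 3 * L * F + 6 * K ^ 2 * m ^ (2 / 3 : ℝ) * D
  rw [hsplit, mul_add]
  exact add_le_add hlow hhigh

end Summit.NavierStokesRegularity.NavierStokesRegularity.Theorems.IntenseSetDoors

end
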